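import Literature.NumberTheory.Weil1964.ThetaLift
import Literature.NumberTheory.Automorphic.AdelicGroupData
import Mathlib.Topology.UniformSpace.CompactConvergence
import HarnessLib

/-!
# Weighted slice integrals of a theta kernel: continuity, bounds, uniform convergence in `Φ`; descent through `Quotient.out` on `[G]²`

Track B ∕ hLiu418 = stmt-HodgeConjecture-24832, line `K2_Liu_CurveThetaSigs`, unit U6 (ED. 4), socket #44∕45 `sig_K2LiuUndoublingSeparation`, organ (O45)(i)
«continuity of `Φ ↦ pairing`» — GENERIC HALF (seat `hodgecm-mathlib-K2Liu-p03` (g2); consumer ★ `Theorems/K2LiuDoubledThetaPairingContinuous`).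

* §0–§1, for ANY ★ `Weil1964.ThetaKernelDatum M` with compact SECOND quotient `G ⧸ Γ`, a finite Borel measure `ν` on it and a weight `f ∈ C(G ⧸ Γ, ℂ)`
  (the first quotient `GU ⧸ ΓU` may be NON-compact — the doubled group `U(𝔻)` is split — so ★ `ThetaKernelDatum.thetaLift` does not apply and we
  work with the raw slice integrals `p ↦ ∫ f(q) θ_Φ(p, q) dν(q)` of ★ D8 `doubledLineThetaLift`): integrability of slices, the estimate
  `‖∫ f θ_Φ(p, ·) − ∫ f θ_{Φ₀}(p₀, ·)‖ ≤ ‖f‖ δ ν(univ)`, CONTINUITY in `p` (`continuous_integral_thetaKer`: `p ↦ θ_Φ(p, ·) ∈ C(G ⧸ Γ, ℂ)` is continuous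
  for the compact-open = uniform topology, Mathlib `ContinuousMap.curry`, `tendsto_iff_tendstoUniformly`), a bound on compacta, and UNIFORM CONVERGENCE
  in `Φ` on compacta (`thetaKer_integral_uniformOn`, from ★ `ThetaKernelDatum.continuous_thetaKer` and Mathlib
  `ContinuousMap.tendsto_iff_forall_isCompact_tendstoUniformlyOn`).
* §2, for ANY `AdelicGroupData 𝒢`: a continuous map on `G(𝔸)²`, right-invariant under `A_G G(K)` in each variable, read through `Quotient.out`
  (as ★ D4 `toQuotFun₂` does) is continuous on `[G]²` (`continuous_out_of_invariant₂`; `mk × mk` is an open quotient map).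

No definition, no instance, no named fact; axioms ⊆ {propext, Classical.choice, Quot.sound}.

## References
* A. Weil, *Sur certains groupes d'opérateurs unitaires*, Acta Math. 111 (1964), Chap. III n° 39–41 [Weil1964].
* M. Harris, S. Kudla, W. J. Sweet, *Theta dichotomy for unitary groups*, J. AMS 9 (1996), §1 proof of Lem. 1.1 [HarrisKudlaSweet1996].
* Y. Liu, *Fourier–Jacobi cycles and arithmetic relative trace formula*, Invent. Math. (2021), §B.3 (B.7) [Liu2021].

HONEST LABEL: HC_CM is proved only modulo the 7 printed citations (2 remaining named inputs: hLiu418 =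
stmt-HodgeConjecture-24832, h413 = stmt-HodgeConjecture-24833) until rung 0 closes; this helper moves no counter.
-/

noncomputable section

set_option autoImplicit false

set_option linter.dupNamespace false

open MeasureTheory Filter Set
open scoped Topology

namespace Summit.HodgeConjecture.HodgeConjecture.Cruxes.HLiu418.K2LiuThetaKernelSliceIntegral

open Literature.NumberTheory.Automorphic Literature.NumberTheory.Weil1964

/-! ## §0 An integral estimate -/

/-- **`‖∫ f − ∫ g‖ ≤ δ · ν(univ)`** when `‖f − g‖ ≤ δ` pointwise and both are integrable (finite measure). [cite: HarrisKudlaSweet1996, §1 proof of Lem. 1.1] -/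
theorem norm_integral_sub_le_of_forall {α : Type*} [MeasurableSpace α] {ν : Measure α} [IsFiniteMeasure ν] {f g : α → ℂ}
    (hf : Integrable f ν) (hg : Integrable g ν) {δ : ℝ} (h : ∀ q, ‖f q - g q‖ ≤ δ) :
    ‖(∫ q, f q ∂ν) - ∫ q, g q ∂ν‖ ≤ δ * ν.real univ := by
  rw [← integral_sub hf hg]
  exact norm_integral_le_of_norm_le_const (Eventually.of_forall h)

/-! ## §1 Weighted slice integrals of a theta kernel: continuity, bounds, uniform convergence in `Φ` -/

section Generic

universe u v

variable {Mp : Type u} {SX : Type v} [TopologicalSpace Mp] [Group Mp] [TopologicalSpace SX]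
variable {GU : Type*} [Group GU] [TopologicalSpace GU] [IsTopologicalGroup GU] {ΓU : Subgroup GU}
variable {G : Type*} [Group G] [TopologicalSpace G] [IsTopologicalGroup G] {Γ : Subgroup G}
variable (M : ThetaKernelDatum Mp SX GU ΓU G Γ)
variable [CompactSpace (G ⧸ Γ)] [MeasurableSpace (G ⧸ Γ)] [BorelSpace (G ⧸ Γ)] (ν : Measure (G ⧸ Γ)) [IsFiniteMeasure ν]
  (f : C(G ⧸ Γ, ℂ))

/-- **The weighted slice `q ↦ f(q) θ_Φ(p, q)` is integrable** (continuous on the compact `G ⧸ Γ`, finite measure). [cite: Weil1964, Chap. III n° 39 p. 189] -/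
theorem integrable_thetaKer_slice (Φ : SX) (p : GU ⧸ ΓU) : Integrable (fun q => f q * M.thetaKer Φ (p, q)) ν :=
  (f.continuous.mul ((M.thetaKer Φ).continuous.comp (Continuous.prodMk_right p))).integrable_of_hasCompactSupport
    (HasCompactSupport.of_compactSpace _)

/-- **Pointwise-to-integral estimate for weighted slices**: if `‖θ_Φ(p, q) − θ_{Φ₀}(p₀, q)‖ ≤ δ` for all `q` then
`‖∫ f θ_Φ(p, ·) − ∫ f θ_{Φ₀}(p₀, ·)‖ ≤ ‖f‖ δ ν(univ)`. [cite: HarrisKudlaSweet1996, §1 proof of Lem. 1.1] -/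
theorem norm_integral_thetaKer_sub_le {Φ Φ₀ : SX} {p p₀ : GU ⧸ ΓU} {δ : ℝ}
    (h : ∀ q, ‖M.thetaKer Φ (p, q) - M.thetaKer Φ₀ (p₀, q)‖ ≤ δ) :
    ‖(∫ q, f q * M.thetaKer Φ (p, q) ∂ν) - ∫ q, f q * M.thetaKer Φ₀ (p₀, q) ∂ν‖ ≤ ‖f‖ * δ * ν.real univ := by
  refine norm_integral_sub_le_of_forall (integrable_thetaKer_slice M ν f Φ p) (integrable_thetaKer_slice M ν f Φ₀ p₀) fun q => ?_
  rw [← mul_sub, norm_mul]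
  exact mul_le_mul (f.norm_coe_le_norm q) (h q) (norm_nonneg _) (norm_nonneg _) |>.trans_eq' (by ring_nf)

/-- **Continuity of the weighted slice integral in the first variable**: `p ↦ ∫ f(q) θ_Φ(p, q) dν(q)` is continuous on `GU ⧸ ΓU`
(NO compactness of `GU ⧸ ΓU`: `p ↦ θ_Φ(p, ·) ∈ C(G ⧸ Γ, ℂ)` is continuous for the compact-open = uniform topology, Mathlib `ContinuousMap.curry`,
`ContinuousMap.tendsto_iff_tendstoUniformly`). [cite: Weil1964, Chap. III n° 39 p. 189] -/
theorem continuous_integral_thetaKer (Φ : SX) : Continuous fun p : GU ⧸ ΓU => ∫ q, f q * M.thetaKer Φ (p, q) ∂ν := by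
  refine continuous_iff_continuousAt.2 fun p₀ => ?_
  rw [ContinuousAt, Metric.tendsto_nhds]
  intro ε hε
  have hcurry : Tendsto (fun p => (M.thetaKer Φ).curry p) (𝓝 p₀) (𝓝 ((M.thetaKer Φ).curry p₀)) :=
    (M.thetaKer Φ).curry.continuous.tendsto p₀
  rw [ContinuousMap.tendsto_iff_tendstoUniformly, Metric.tendstoUniformly_iff] at hcurry
  have hν : 0 ≤ ν.real univ := measureReal_nonneg
  set δ : ℝ := ε / ((‖f‖ + 1) * (ν.real univ + 1)) with hδ
  have hden : 0 < (‖f‖ + 1) * (ν.real univ + 1) := by positivity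
  have hδ0 : 0 < δ := div_pos hε hden
  filter_upwards [hcurry δ hδ0] with p hp
  rw [dist_eq_norm]
  calc ‖(∫ q, f q * M.thetaKer Φ (p, q) ∂ν) - ∫ q, f q * M.thetaKer Φ (p₀, q) ∂ν‖ ≤ ‖f‖ * δ * ν.real univ :=
        norm_integral_thetaKer_sub_le M ν f fun q => by
          have h := hp q
          rw [dist_comm, dist_eq_norm] at h
          exact h.le
    _ < ε := by
        have h1 : ‖f‖ * δ * ν.real univ ≤ (‖f‖ + 1) * δ * (ν.real univ + 1) := by
          have := norm_nonneg f
          nlinarith [mul_nonneg (mul_nonneg this hδ0.le) hν, mul_nonneg this hδ0.le]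
        have h2 : (‖f‖ + 1) * δ * (ν.real univ + 1) = ε := by
          rw [hδ]; field_simp
        linarith [h1, h2.le, show (‖f‖ + 1) * δ * (ν.real univ + 1) - ‖f‖ * δ * ν.real univ > 0 from by
          nlinarith [norm_nonneg f, mul_pos hδ0 (by linarith : (0:ℝ) < ν.real univ + 1)]]

omit [BorelSpace (G ⧸ Γ)] in
/-- **Bound on a compact set**: `sup_{p ∈ K} ‖∫ f(q) θ_Φ(p, q) dν(q)‖ < ∞` for compact `K ⊆ GU ⧸ ΓU`. [cite: Weil1964, Chap. III n° 39 p. 189] -/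
theorem exists_bound_integral_thetaKer (Φ : SX) {K : Set (GU ⧸ ΓU)} (hK : IsCompact K) :
    ∃ C : ℝ, ∀ p ∈ K, ‖∫ q, f q * M.thetaKer Φ (p, q) ∂ν‖ ≤ C := by
  obtain ⟨C, hC⟩ := (hK.prod isCompact_univ).exists_bound_of_continuousOn (M.thetaKer Φ).continuous.continuousOn
  refine ⟨‖f‖ * max C 0 * ν.real univ, fun p hp => ?_⟩
  refine norm_integral_le_of_norm_le_const (Eventually.of_forall fun q => ?_)
  rw [norm_mul]
  exact mul_le_mul (f.norm_coe_le_norm q) ((hC (p, q) ⟨hp, mem_univ _⟩).trans (le_max_left _ _)) (norm_nonneg _) (norm_nonneg _)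

/-- **Uniform convergence in `Φ` on compacta**: for compact `K ⊆ GU ⧸ ΓU` and `ε > 0`, eventually as `Φ → Φ₀`,
`‖∫ f θ_Φ(p, ·) dν − ∫ f θ_{Φ₀}(p, ·) dν‖ ≤ ε` for ALL `p ∈ K` (★ `continuous_thetaKer` is continuity into the compact-open topology = uniform convergence
on the compact `K × (G ⧸ Γ)`). [cite: Weil1964, Chap. III n° 39 p. 189] [cite: HarrisKudlaSweet1996, §1 proof of Lem. 1.1] -/
theorem thetaKer_integral_uniformOn {K : Set (GU ⧸ ΓU)} (hK : IsCompact K) (Φ₀ : SX) {ε : ℝ} (hε : 0 < ε) :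
    ∀ᶠ Φ in 𝓝 Φ₀, ∀ p ∈ K, ‖(∫ q, f q * M.thetaKer Φ (p, q) ∂ν) - ∫ q, f q * M.thetaKer Φ₀ (p, q) ∂ν‖ ≤ ε := by
  have ht := ContinuousMap.tendsto_iff_forall_isCompact_tendstoUniformlyOn.mp (M.continuous_thetaKer.tendsto Φ₀) _
    (hK.prod isCompact_univ)
  rw [Metric.tendstoUniformlyOn_iff] at ht
  have hν : 0 ≤ ν.real univ := measureReal_nonneg
  set δ : ℝ := ε / ((‖f‖ + 1) * (ν.real univ + 1)) with hδ
  have hden : 0 < (‖f‖ + 1) * (ν.real univ + 1) := by positivity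
  have hδ0 : 0 < δ := div_pos hε hden
  filter_upwards [ht δ hδ0] with Φ hΦ p hp
  calc ‖(∫ q, f q * M.thetaKer Φ (p, q) ∂ν) - ∫ q, f q * M.thetaKer Φ₀ (p, q) ∂ν‖ ≤ ‖f‖ * δ * ν.real univ :=
        norm_integral_thetaKer_sub_le M ν f fun q => by
          have h := hΦ (p, q) ⟨hp, mem_univ _⟩
          rw [dist_comm, dist_eq_norm] at h
          exact h.le
    _ ≤ ε := by
        have h1 : ‖f‖ * δ * ν.real univ ≤ (‖f‖ + 1) * δ * (ν.real univ + 1) := by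
          have := norm_nonneg f
          nlinarith [mul_nonneg (mul_nonneg this hδ0.le) hν, mul_nonneg this hδ0.le]
        have h2 : (‖f‖ + 1) * δ * (ν.real univ + 1) = ε := by
          rw [hδ]; field_simp
        linarith

end Generic

/-! ## §2 Descent of invariant continuous maps on `G(𝔸)²` through `Quotient.out` -/

section Descent

variable {K : Type} [Field K] [NumberField K] (𝒢 : AdelicGroupData.{0} K)

/-- **Reading an invariant continuous map through representatives is continuous on `[G]²`**: if `ψ : G(𝔸)² → X` is continuous and
RIGHT-invariant under `A_G G(K)` in each variable, then `x ↦ ψ(out x₁, out x₂)` is continuous on `[G] × [G]` (it is the descent of `ψ`;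
`mk × mk` is a quotient map). [cite: Liu2021, §B.3 (B.7) p. 101] -/
theorem continuous_out_of_invariant₂ {X : Type*} [TopologicalSpace X] (ψ : 𝒢.Adelic × 𝒢.Adelic → X) (hψ : Continuous ψ)
    (h₁ : ∀ γ ∈ 𝒢.quotientSubgroup, ∀ g₁ g₂, ψ (g₁ * γ, g₂) = ψ (g₁, g₂))
    (h₂ : ∀ γ ∈ 𝒢.quotientSubgroup, ∀ g₁ g₂, ψ (g₁, g₂ * γ) = ψ (g₁, g₂)) :
    Continuous fun x : 𝒢.automorphicQuotient × 𝒢.automorphicQuotient =>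
      ψ (((Quotient.out (x.1 : 𝒢.Adelic ⧸ 𝒢.quotientSubgroup)) : 𝒢.Adelic),
        ((Quotient.out (x.2 : 𝒢.Adelic ⧸ 𝒢.quotientSubgroup)) : 𝒢.Adelic)) := by
  have hq : Topology.IsQuotientMap (Prod.map (QuotientGroup.mk : 𝒢.Adelic → 𝒢.Adelic ⧸ 𝒢.quotientSubgroup)
      (QuotientGroup.mk : 𝒢.Adelic → 𝒢.Adelic ⧸ 𝒢.quotientSubgroup)) :=
    (QuotientGroup.isOpenMap_coe.prodMap QuotientGroup.isOpenMap_coe).isQuotientMap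
      (continuous_quotient_mk'.prodMap continuous_quotient_mk')
      (QuotientGroup.mk_surjective.prodMap QuotientGroup.mk_surjective)
  change Continuous (fun x : (𝒢.Adelic ⧸ 𝒢.quotientSubgroup) × (𝒢.Adelic ⧸ 𝒢.quotientSubgroup) =>
        ψ ((Quotient.out x.1 : 𝒢.Adelic), (Quotient.out x.2 : 𝒢.Adelic)))
  rw [hq.continuous_iff]
  have he : (fun x : (𝒢.Adelic ⧸ 𝒢.quotientSubgroup) × (𝒢.Adelic ⧸ 𝒢.quotientSubgroup) =>
        ψ ((Quotient.out x.1 : 𝒢.Adelic), (Quotient.out x.2 : 𝒢.Adelic))) ∘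
      Prod.map (QuotientGroup.mk : 𝒢.Adelic → 𝒢.Adelic ⧸ 𝒢.quotientSubgroup) (QuotientGroup.mk : 𝒢.Adelic → 𝒢.Adelic ⧸ 𝒢.quotientSubgroup) = ψ := by
    funext g
    obtain ⟨k₁, hk₁⟩ := QuotientGroup.mk_out_eq_mul 𝒢.quotientSubgroup g.1
    obtain ⟨k₂, hk₂⟩ := QuotientGroup.mk_out_eq_mul 𝒢.quotientSubgroup g.2
    simp only [Function.comp_apply, Prod.map_fst, Prod.map_snd]
    rw [hk₁, hk₂, h₁ _ k₁.2, h₂ _ k₂.2]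
  rw [he]
  exact hψ

end Descent

end Summit.HodgeConjecture.HodgeConjecture.Cruxes.HLiu418.K2LiuThetaKernelSliceIntegral

end
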